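import Literature.Geometry.Kaehler.ComplexTorusWeilStructure
import HarnessLib

/-!
# Transcendence statements for the explicit Weil torus: distinct powers of `t`

Second file of the simplicity proof for the explicit complex torus of Weil type
(`ComplexTorusWeilStructure.lean`, `ComplexTorusWeilSimple.lean`; C. Voisin, IMRN 2002 no. 20, §3
Prop. 3 (ii)). The exponents of `T₁ = (t, t²; t³, t⁵)` and `T₂ = (t¹⁰, t²⁰; t³⁰, t⁵⁰)` were chosen so
that in each identity below NO TWO MONOMIALS COLLIDE; since the period `t` is transcendental, a
vanishing `ℚ(i)`-combination of distinct powers of `t` has vanishing coefficients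
(`eq_zero_of_sum_rat_mul_pow_eq_zero`, real and imaginary parts). The four statements consumed by the
simplicity proof, for Gaussian-rational data (`gaussVec a b`, `a b : Fin 4 → ℚ`):

* (T1) `gaussVec_eq_zero_of_mem_NP`, `gaussVec_eq_zero_of_mem_NQ`: no non-zero Gaussian-rational
  vector lies in `N_P` or in `N_Q`;
* (T2) `gaussVec_eq_zero_of_dot_h`, `gaussVec_eq_zero_of_dot_g`: no non-zero Gaussian-rational
  covector kills `N_Q = ⟨h₁, h₂⟩` or `N_P = ⟨g₁, g₂⟩`;
* (T3) `minors_eq_zero_of_det_eq_zero`: if `(c·h₁)(c'·h₂) - (c·h₂)(c'·h₁) = 0` for Gaussian-rational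
  covectors `c, c'`, then all `2 × 2` minors of `(c, c')` vanish;
* (T4) `eq_zero_of_map_NQ_le_NP`: a `ℂ`-linear map of `ℂ⁴` with Gaussian-rational matrix mapping
  `N_Q` into `N_P` is zero (the block identity `M_a - M_b T₂ + T₁ M_c - T₁ M_d T₂ = 0`, nine distinct
  powers of `t` per entry).

No definition and no named fact is introduced.

## References

* C. Voisin, *A counterexample to the Hodge conjecture extended to Kähler varieties*, IMRN 2002
  no. 20, 1057–1075 (arXiv:math/0112247), §3 p. 5 (the torus of Weil type, `W = W_i ⊕ W_{-i}`,
  `W ∩ Γ_ℝ = {0}`) and Prop. 3 (ii) ("`X` is simple" for the general member).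
  [Voisin2002KaehlerCounterexample]
* Ch. Birkenhake, H. Lange, *Complex Abelian Varieties* (1992), §1.1–1.2 (period matrices, complex
  subtori and rational complex subspaces). [LangeBirkenhake1992]
-/

noncomputable section

open scoped ComplexConjugate Matrix
open Polynomial Module

namespace Literature.Geometry.Kaehler

namespace Weil

/-! ### Transcendence with Gaussian-rational coefficients -/

/-- **Distinct powers of the (real) transcendental period are `ℚ(i)`-linearly independent**:
if `∑_{n ∈ S} (αₙ + i βₙ) tⁿ = 0` with `αₙ, βₙ ∈ ℚ` then all `αₙ = βₙ = 0` (real and imaginary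
parts, then `eq_zero_of_sum_mul_pow_eq_zero`). [folklore] -/
theorem eq_zero_of_sum_gauss_mul_pow_eq_zero (S : Finset ℕ) (α β : ℕ → ℚ)
    (h : ∑ n ∈ S, ((α n : ℂ) + (β n : ℂ) * Complex.I) * (tV : ℂ) ^ n = 0) :
    ∀ n ∈ S, α n = 0 ∧ β n = 0 := by
  have hre := congrArg Complex.re h
  have him := congrArg Complex.im h
  rw [Complex.re_sum] at hre
  rw [Complex.im_sum] at him
  simp only [← Complex.ofReal_pow, Complex.mul_re, Complex.mul_im, Complex.add_re, Complex.add_im,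
    Complex.ratCast_re, Complex.ratCast_im, Complex.I_re, Complex.I_im, Complex.ofReal_re,
    Complex.ofReal_im, Complex.zero_re, Complex.zero_im, mul_zero, mul_one, zero_add, add_zero,
    sub_zero] at hre him
  have hα : ∑ n ∈ S, ((α n : ℚ) : ℂ) * (tV : ℂ) ^ n = 0 := by
    have : ∑ n ∈ S, ((α n : ℚ) : ℂ) * (tV : ℂ) ^ n = ((∑ n ∈ S, (α n : ℝ) * tV ^ n : ℝ) : ℂ) := by
      push_cast; rfl
    rw [this, hre, Complex.ofReal_zero]
  have hβ : ∑ n ∈ S, ((β n : ℚ) : ℂ) * (tV : ℂ) ^ n = 0 := by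
    have : ∑ n ∈ S, ((β n : ℚ) : ℂ) * (tV : ℂ) ^ n = ((∑ n ∈ S, (β n : ℝ) * tV ^ n : ℝ) : ℂ) := by
      push_cast; rfl
    rw [this, him, Complex.ofReal_zero]
  intro n hn
  exact ⟨eq_zero_of_sum_mul_pow_eq_zero transcendental_tV_complex S α hα n hn,
    eq_zero_of_sum_mul_pow_eq_zero transcendental_tV_complex S β hβ n hn⟩


/-! ### Transcendence over `ℝ`: distinct powers of `t` with rational coefficients -/

/-- Real form of `eq_zero_of_sum_mul_pow_eq_zero`: `∑_{n ∈ S} αₙ tⁿ = 0` in `ℝ` with `αₙ ∈ ℚ`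
forces all `αₙ = 0`. [folklore] -/
theorem eq_zero_of_sum_rat_mul_pow_eq_zero (S : Finset ℕ) (α : ℕ → ℚ)
    (h : ∑ n ∈ S, (α n : ℝ) * tV ^ n = 0) : ∀ n ∈ S, α n = 0 := by
  have h' : ∑ n ∈ S, ((α n : ℚ) : ℂ) * (tV : ℂ) ^ n = 0 := by
    have : ∑ n ∈ S, ((α n : ℚ) : ℂ) * (tV : ℂ) ^ n = ((∑ n ∈ S, (α n : ℝ) * tV ^ n : ℝ) : ℂ) := by
      push_cast; rfl
    rw [this, h, Complex.ofReal_zero]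
  exact eq_zero_of_sum_mul_pow_eq_zero transcendental_tV_complex S α h'

/-- **(T1a)** A Gaussian-rational vector in `N_P` is zero: `P u = 0` reads
`(a₀ + i b₀) + (a₂ + i b₂) t + (a₃ + i b₃) t² = 0`, `(a₁ + i b₁) + (a₂ + i b₂) t³ + (a₃ + i b₃) t⁵ = 0`.
[cite: Voisin2002KaehlerCounterexample, §3 Prop. 3 (ii)] -/
theorem gaussVec_eq_zero_of_mem_NP (a b : Fin 4 → ℚ) (h : gaussVec a b ∈ NP) : a = 0 ∧ b = 0 := by
  rw [mem_NP, Pmap_apply] at h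
  have e0 := congrFun h 0
  have e1 := congrFun h 1
  simp only [Matrix.cons_val_zero, Matrix.cons_val_one, Pi.zero_apply] at e0 e1
  have r0 := congrArg Complex.re e0
  have i0 := congrArg Complex.im e0
  have r1 := congrArg Complex.re e1
  have i1 := congrArg Complex.im e1
  simp only [← Complex.ofReal_pow, Complex.add_re, Complex.add_im, Complex.mul_re, Complex.mul_im,
    Complex.ofReal_re, Complex.ofReal_im, gaussVec_re, gaussVec_im, Complex.zero_re,
    Complex.zero_im, zero_mul, sub_zero, add_zero] at r0 i0 r1 i1
  -- coefficient extraction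
  have A := eq_zero_of_sum_rat_mul_pow_eq_zero {0, 1, 2}
    (fun n ↦ if n = 0 then a 0 else if n = 1 then a 2 else a 3) (by
      norm_num; linear_combination r0)
  have B := eq_zero_of_sum_rat_mul_pow_eq_zero {0, 1, 2}
    (fun n ↦ if n = 0 then b 0 else if n = 1 then b 2 else b 3) (by
      norm_num; linear_combination i0)
  have a0 := A 0 (by simp); have a2 := A 1 (by simp); have a3 := A 2 (by simp)
  have b0 := B 0 (by simp); have b2 := B 1 (by simp); have b3 := B 2 (by simp)
  simp only [if_true, one_ne_zero, if_false, OfNat.ofNat_ne_zero, OfNat.ofNat_ne_one] at a0 a2 a3 b0 b2 b3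
  have A1 := eq_zero_of_sum_rat_mul_pow_eq_zero {0, 3, 5}
    (fun n ↦ if n = 0 then a 1 else if n = 3 then a 2 else a 3) (by
      norm_num; linear_combination r1)
  have B1 := eq_zero_of_sum_rat_mul_pow_eq_zero {0, 3, 5}
    (fun n ↦ if n = 0 then b 1 else if n = 3 then b 2 else b 3) (by
      norm_num; linear_combination i1)
  have a1 := A1 0 (by simp); have b1 := B1 0 (by simp)
  simp only [if_true] at a1 b1
  refine ⟨funext fun m ↦ ?_, funext fun m ↦ ?_⟩ <;> fin_cases m <;> simp <;> assumption

/-- **(T1b)** A Gaussian-rational vector in `N_Q` is zero: `Q u = 0` reads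
`t¹⁰ u₀ + t²⁰ u₁ + u₂ = 0`, `t³⁰ u₀ + t⁵⁰ u₁ + u₃ = 0`. [cite: Voisin2002KaehlerCounterexample, §3 Prop. 3 (ii)] -/
theorem gaussVec_eq_zero_of_mem_NQ (a b : Fin 4 → ℚ) (h : gaussVec a b ∈ NQ) : a = 0 ∧ b = 0 := by
  rw [mem_NQ, Qmap_apply] at h
  have e0 := congrFun h 0
  have e1 := congrFun h 1
  simp only [Matrix.cons_val_zero, Matrix.cons_val_one, Pi.zero_apply] at e0 e1
  have r0 := congrArg Complex.re e0
  have i0 := congrArg Complex.im e0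
  have r1 := congrArg Complex.re e1
  have i1 := congrArg Complex.im e1
  simp only [← Complex.ofReal_pow, Complex.add_re, Complex.add_im, Complex.mul_re, Complex.mul_im,
    Complex.ofReal_re, Complex.ofReal_im, gaussVec_re, gaussVec_im, Complex.zero_re,
    Complex.zero_im, zero_mul, sub_zero, add_zero] at r0 i0 r1 i1
  have A := eq_zero_of_sum_rat_mul_pow_eq_zero {0, 10, 20} (fun n ↦ if n = 0 then a 2 else if n = 10 then a 0 else a 1) (by
      norm_num; linear_combination r0)
  have B := eq_zero_of_sum_rat_mul_pow_eq_zero {0, 10, 20} (fun n ↦ if n = 0 then b 2 else if n = 10 then b 0 else b 1) (by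
      norm_num; linear_combination i0)
  have A1 := eq_zero_of_sum_rat_mul_pow_eq_zero {0, 30, 50} (fun n ↦ if n = 0 then a 3 else if n = 30 then a 0 else a 1) (by
      norm_num; linear_combination r1)
  have B1 := eq_zero_of_sum_rat_mul_pow_eq_zero {0, 30, 50} (fun n ↦ if n = 0 then b 3 else if n = 30 then b 0 else b 1) (by
      norm_num; linear_combination i1)
  have a2 := A 0 (by simp); have a0 := A 10 (by simp); have a1 := A 20 (by simp)
  have b2 := B 0 (by simp); have b0 := B 10 (by simp); have b1 := B 20 (by simp)
  have a3 := A1 0 (by simp); have b3 := B1 0 (by simp)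
  norm_num at a2 a0 a1 b2 b0 b1 a3 b3
  refine ⟨funext fun m ↦ ?_, funext fun m ↦ ?_⟩ <;> fin_cases m <;> simp <;> assumption

/-- **(T2a)** A Gaussian-rational covector killing `N_Q` is zero: `c·h₁ = c₀ - t¹⁰ c₂ - t³⁰ c₃`,
`c·h₂ = c₁ - t²⁰ c₂ - t⁵⁰ c₃`. [cite: Voisin2002KaehlerCounterexample, §3 Prop. 3 (ii)] -/
theorem gaussVec_eq_zero_of_dot_h (a b : Fin 4 → ℚ) (hh₁ : gaussVec a b ⬝ᵥ h₁ = 0) (hh₂ : gaussVec a b ⬝ᵥ h₂ = 0) :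
    a = 0 ∧ b = 0 := by
  simp only [dotProduct, Fin.sum_univ_four, h₁, h₂, Matrix.cons_val_zero, Matrix.cons_val_one,
    Matrix.cons_val] at hh₁ hh₂
  have r0 := congrArg Complex.re hh₁
  have i0 := congrArg Complex.im hh₁
  have r1 := congrArg Complex.re hh₂
  have i1 := congrArg Complex.im hh₂
  simp only [← Complex.ofReal_pow, Complex.add_re, Complex.add_im, Complex.mul_re, Complex.mul_im,
    Complex.neg_re, Complex.neg_im, Complex.ofReal_re, Complex.ofReal_im, gaussVec_re, gaussVec_im,
    Complex.zero_re, Complex.zero_im, mul_zero, add_zero, mul_one] at r0 i0 r1 i1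
  have A := eq_zero_of_sum_rat_mul_pow_eq_zero {0, 10, 30} (fun n ↦ if n = 0 then a 0 else if n = 10 then -a 2 else -a 3) (by
      norm_num; linear_combination r0)
  have B := eq_zero_of_sum_rat_mul_pow_eq_zero {0, 10, 30} (fun n ↦ if n = 0 then b 0 else if n = 10 then -b 2 else -b 3) (by
      norm_num; linear_combination i0)
  have A1 := eq_zero_of_sum_rat_mul_pow_eq_zero {0, 20, 50} (fun n ↦ if n = 0 then a 1 else if n = 20 then -a 2 else -a 3) (by
      norm_num; linear_combination r1)
  have B1 := eq_zero_of_sum_rat_mul_pow_eq_zero {0, 20, 50} (fun n ↦ if n = 0 then b 1 else if n = 20 then -b 2 else -b 3) (by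
      norm_num; linear_combination i1)
  have a0 := A 0 (by simp); have a2 := A 10 (by simp); have a3 := A 30 (by simp)
  have b0 := B 0 (by simp); have b2 := B 10 (by simp); have b3 := B 30 (by simp)
  have a1 := A1 0 (by simp); have b1 := B1 0 (by simp)
  norm_num at a0 a2 a3 b0 b2 b3 a1 b1
  refine ⟨funext fun m ↦ ?_, funext fun m ↦ ?_⟩ <;> fin_cases m <;> simp <;> assumption

/-- **(T2b)** A Gaussian-rational covector killing `N_P` is zero: `c·g₁ = -t c₀ - t³ c₁ + c₂`,
`c·g₂ = -t² c₀ - t⁵ c₁ + c₃`. [cite: Voisin2002KaehlerCounterexample, §3 Prop. 3 (ii)] -/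
theorem gaussVec_eq_zero_of_dot_g (a b : Fin 4 → ℚ) (hh₁ : gaussVec a b ⬝ᵥ g₁ = 0) (hh₂ : gaussVec a b ⬝ᵥ g₂ = 0) :
    a = 0 ∧ b = 0 := by
  simp only [dotProduct, Fin.sum_univ_four, g₁, g₂, Matrix.cons_val_zero, Matrix.cons_val_one,
    Matrix.cons_val] at hh₁ hh₂
  have r0 := congrArg Complex.re hh₁
  have i0 := congrArg Complex.im hh₁
  have r1 := congrArg Complex.re hh₂
  have i1 := congrArg Complex.im hh₂
  simp only [← Complex.ofReal_pow, Complex.add_re, Complex.add_im, Complex.mul_re, Complex.mul_im,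
    Complex.neg_re, Complex.neg_im, Complex.ofReal_re, Complex.ofReal_im, gaussVec_re, gaussVec_im,
    Complex.zero_re, Complex.zero_im, mul_zero, add_zero, mul_one] at r0 i0 r1 i1
  have A := eq_zero_of_sum_rat_mul_pow_eq_zero {0, 1, 3} (fun n ↦ if n = 0 then a 2 else if n = 1 then -a 0 else -a 1) (by
      norm_num; linear_combination r0)
  have B := eq_zero_of_sum_rat_mul_pow_eq_zero {0, 1, 3} (fun n ↦ if n = 0 then b 2 else if n = 1 then -b 0 else -b 1) (by
      norm_num; linear_combination i0)
  have A1 := eq_zero_of_sum_rat_mul_pow_eq_zero {0, 2, 5} (fun n ↦ if n = 0 then a 3 else if n = 2 then -a 0 else -a 1) (by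
      norm_num; linear_combination r1)
  have B1 := eq_zero_of_sum_rat_mul_pow_eq_zero {0, 2, 5} (fun n ↦ if n = 0 then b 3 else if n = 2 then -b 0 else -b 1) (by
      norm_num; linear_combination i1)
  have a2 := A 0 (by simp); have a0 := A 1 (by simp); have a1 := A 3 (by simp)
  have b2 := B 0 (by simp); have b0 := B 1 (by simp); have b1 := B 3 (by simp)
  have a3 := A1 0 (by simp); have b3 := B1 0 (by simp)
  norm_num at a2 a0 a1 b2 b0 b1 a3 b3
  refine ⟨funext fun m ↦ ?_, funext fun m ↦ ?_⟩ <;> fin_cases m <;> simp <;> assumption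

/-- **(T3)** If the `2 × 2` determinant `(c·h₁)(c'·h₂) - (c·h₂)(c'·h₁)` of two Gaussian-rational
covectors on the basis `h₁, h₂` of `N_Q` vanishes, then all `2 × 2` minors `c_j c'_k - c_k c'_j`
vanish: the determinant is `p₀₁ + p₁₂ t¹⁰ - p₀₂ t²⁰ + p₁₃ t³⁰ - (p₀₃ + p₂₃) t⁵⁰ + p₂₃ t⁶⁰`.
[cite: Voisin2002KaehlerCounterexample, §3 Prop. 3 (ii)] -/
theorem minors_eq_zero_of_det_eq_zero (a b a' b' : Fin 4 → ℚ)
    (h : (gaussVec a b ⬝ᵥ h₁) * (gaussVec a' b' ⬝ᵥ h₂) -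
      (gaussVec a b ⬝ᵥ h₂) * (gaussVec a' b' ⬝ᵥ h₁) = 0) :
    ∀ j k : Fin 4, gaussVec a b j * gaussVec a' b' k = gaussVec a b k * gaussVec a' b' j := by
  simp only [dotProduct, Fin.sum_univ_four, h₁, h₂, Matrix.cons_val_zero, Matrix.cons_val_one,
    Matrix.cons_val] at h
  have r0 := congrArg Complex.re h
  have i0 := congrArg Complex.im h
  simp only [← Complex.ofReal_pow, Complex.add_re, Complex.add_im, Complex.sub_re, Complex.sub_im,
    Complex.mul_re, Complex.mul_im, Complex.neg_re, Complex.neg_im, Complex.ofReal_re,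
    Complex.ofReal_im, gaussVec_re, gaussVec_im, Complex.zero_re, Complex.zero_im,
    mul_zero, add_zero, mul_one, zero_add] at r0 i0
  have A := eq_zero_of_sum_rat_mul_pow_eq_zero {0, 10, 20, 30, 50, 60}
    (fun n ↦ if n = 0 then (a 0 * a' 1 - b 0 * b' 1 - (a 1 * a' 0 - b 1 * b' 0)) else if n = 10 then (a 1 * a' 2 - b 1 * b' 2 - (a 2 * a' 1 - b 2 * b' 1)) else if n = 20 then -(a 0 * a' 2 - b 0 * b' 2 - (a 2 * a' 0 - b 2 * b' 0)) else if n = 30 then (a 1 * a' 3 - b 1 * b' 3 - (a 3 * a' 1 - b 3 * b' 1)) else if n = 50 then -(a 0 * a' 3 - b 0 * b' 3 - (a 3 * a' 0 - b 3 * b' 0)) - (a 2 * a' 3 - b 2 * b' 3 - (a 3 * a' 2 - b 3 * b' 2)) else (a 2 * a' 3 - b 2 * b' 3 - (a 3 * a' 2 - b 3 * b' 2))) (by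
      norm_num; linear_combination r0)
  have B := eq_zero_of_sum_rat_mul_pow_eq_zero {0, 10, 20, 30, 50, 60}
    (fun n ↦ if n = 0 then (a 0 * b' 1 + b 0 * a' 1 - (a 1 * b' 0 + b 1 * a' 0)) else if n = 10 then (a 1 * b' 2 + b 1 * a' 2 - (a 2 * b' 1 + b 2 * a' 1)) else if n = 20 then -(a 0 * b' 2 + b 0 * a' 2 - (a 2 * b' 0 + b 2 * a' 0)) else if n = 30 then (a 1 * b' 3 + b 1 * a' 3 - (a 3 * b' 1 + b 3 * a' 1)) else if n = 50 then -(a 0 * b' 3 + b 0 * a' 3 - (a 3 * b' 0 + b 3 * a' 0)) - (a 2 * b' 3 + b 2 * a' 3 - (a 3 * b' 2 + b 3 * a' 2)) else (a 2 * b' 3 + b 2 * a' 3 - (a 3 * b' 2 + b 3 * a' 2))) (by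
      norm_num; linear_combination i0)
  have ra := A 0 (by simp); have rb := A 10 (by simp); have rc := A 20 (by simp)
  have rd := A 30 (by simp); have re := A 50 (by simp); have rf := A 60 (by simp)
  have ia := B 0 (by simp); have ib := B 10 (by simp); have ic := B 20 (by simp)
  have id := B 30 (by simp); have ie := B 50 (by simp); have iF := B 60 (by simp)
  norm_num at ra rb rc rd re rf ia ib ic id ie iF
  have Ra : (((a 0 * a' 1 - b 0 * b' 1 - (a 1 * a' 0 - b 1 * b' 0)) : ℚ) : ℝ) = 0 := by rw [ra, Rat.cast_zero]
  have Rb : (((a 1 * a' 2 - b 1 * b' 2 - (a 2 * a' 1 - b 2 * b' 1)) : ℚ) : ℝ) = 0 := by rw [rb, Rat.cast_zero]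
  have Rc : (((a 0 * a' 2 - b 0 * b' 2 - (a 2 * a' 0 - b 2 * b' 0)) : ℚ) : ℝ) = 0 := by
    have : (a 0 * a' 2 - b 0 * b' 2 - (a 2 * a' 0 - b 2 * b' 0)) = 0 := by linear_combination -rc
    rw [this, Rat.cast_zero]
  have Rd : (((a 1 * a' 3 - b 1 * b' 3 - (a 3 * a' 1 - b 3 * b' 1)) : ℚ) : ℝ) = 0 := by rw [rd, Rat.cast_zero]
  have Rf : (((a 2 * a' 3 - b 2 * b' 3 - (a 3 * a' 2 - b 3 * b' 2)) : ℚ) : ℝ) = 0 := by rw [rf, Rat.cast_zero]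
  have Re : (((a 0 * a' 3 - b 0 * b' 3 - (a 3 * a' 0 - b 3 * b' 0)) : ℚ) : ℝ) = 0 := by
    have : (a 0 * a' 3 - b 0 * b' 3 - (a 3 * a' 0 - b 3 * b' 0)) = 0 := by linear_combination -re - rf
    rw [this, Rat.cast_zero]
  have Ia : (((a 0 * b' 1 + b 0 * a' 1 - (a 1 * b' 0 + b 1 * a' 0)) : ℚ) : ℝ) = 0 := by rw [ia, Rat.cast_zero]
  have Ib : (((a 1 * b' 2 + b 1 * a' 2 - (a 2 * b' 1 + b 2 * a' 1)) : ℚ) : ℝ) = 0 := by rw [ib, Rat.cast_zero]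
  have Ic : (((a 0 * b' 2 + b 0 * a' 2 - (a 2 * b' 0 + b 2 * a' 0)) : ℚ) : ℝ) = 0 := by
    have : (a 0 * b' 2 + b 0 * a' 2 - (a 2 * b' 0 + b 2 * a' 0)) = 0 := by linear_combination -ic
    rw [this, Rat.cast_zero]
  have Id : (((a 1 * b' 3 + b 1 * a' 3 - (a 3 * b' 1 + b 3 * a' 1)) : ℚ) : ℝ) = 0 := by rw [id, Rat.cast_zero]
  have If : (((a 2 * b' 3 + b 2 * a' 3 - (a 3 * b' 2 + b 3 * a' 2)) : ℚ) : ℝ) = 0 := by rw [iF, Rat.cast_zero]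
  have Ie : (((a 0 * b' 3 + b 0 * a' 3 - (a 3 * b' 0 + b 3 * a' 0)) : ℚ) : ℝ) = 0 := by
    have : (a 0 * b' 3 + b 0 * a' 3 - (a 3 * b' 0 + b 3 * a' 0)) = 0 := by linear_combination -ie - iF
    rw [this, Rat.cast_zero]
  push_cast at Ra Rb Rc Rd Re Rf Ia Ib Ic Id Ie If
  have q01 : gaussVec a b 0 * gaussVec a' b' 1 = gaussVec a b 1 * gaussVec a' b' 0 := by
    apply Complex.ext <;> simp only [Complex.mul_re, Complex.mul_im, gaussVec_re, gaussVec_im]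
    · linear_combination Ra
    · linear_combination Ia
  have q12 : gaussVec a b 1 * gaussVec a' b' 2 = gaussVec a b 2 * gaussVec a' b' 1 := by
    apply Complex.ext <;> simp only [Complex.mul_re, Complex.mul_im, gaussVec_re, gaussVec_im]
    · linear_combination Rb
    · linear_combination Ib
  have q02 : gaussVec a b 0 * gaussVec a' b' 2 = gaussVec a b 2 * gaussVec a' b' 0 := by
    apply Complex.ext <;> simp only [Complex.mul_re, Complex.mul_im, gaussVec_re, gaussVec_im]
    · linear_combination Rc
    · linear_combination Ic
  have q13 : gaussVec a b 1 * gaussVec a' b' 3 = gaussVec a b 3 * gaussVec a' b' 1 := by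
    apply Complex.ext <;> simp only [Complex.mul_re, Complex.mul_im, gaussVec_re, gaussVec_im]
    · linear_combination Rd
    · linear_combination Id
  have q23 : gaussVec a b 2 * gaussVec a' b' 3 = gaussVec a b 3 * gaussVec a' b' 2 := by
    apply Complex.ext <;> simp only [Complex.mul_re, Complex.mul_im, gaussVec_re, gaussVec_im]
    · linear_combination Rf
    · linear_combination If
  have q03 : gaussVec a b 0 * gaussVec a' b' 3 = gaussVec a b 3 * gaussVec a' b' 0 := by
    apply Complex.ext <;> simp only [Complex.mul_re, Complex.mul_im, gaussVec_re, gaussVec_im]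
    · linear_combination Re
    · linear_combination Ie
  intro j k
  fin_cases j <;> fin_cases k <;> simp [q01, q02, q03, q12, q13, q23]

/-- **(T4)** A `ℂ`-linear map of `ℂ⁴` with Gaussian-rational matrix mapping `N_Q` into `N_P` is
zero: the four entries of `P M (h₁ | h₂) = 0`, i.e. of `M_a - M_b T₂ + T₁ M_c - T₁ M_d T₂ = 0` in
`2 × 2` blocks, are `ℚ(i)`-combinations of NINE DISTINCT powers of `t` each, whose coefficients are
the sixteen entries of `M`. [cite: Voisin2002KaehlerCounterexample, §3 Prop. 3 (ii)] -/
theorem eq_zero_of_map_NQ_le_NP (M : (Fin 4 → ℂ) →ₗ[ℂ] (Fin 4 → ℂ)) (A B : Fin 4 → Fin 4 → ℚ)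
    (hM : ∀ q, M (Pi.single q 1) = gaussCol A B q) (hM₁ : M h₁ ∈ NP) (hM₂ : M h₂ ∈ NP) :
    M = 0 := by
  have eh₁ : h₁ = Pi.single 0 1 - ((tV : ℂ) ^ 10) • Pi.single 2 1 - ((tV : ℂ) ^ 30) • Pi.single 3 1 := by
    funext j; fin_cases j <;> simp [h₁]
  have eh₂ : h₂ = Pi.single 1 1 - ((tV : ℂ) ^ 20) • Pi.single 2 1 - ((tV : ℂ) ^ 50) • Pi.single 3 1 := by
    funext j; fin_cases j <;> simp [h₂]
  have v₁ : ∀ p, M h₁ p = gaussCol A B 0 p - (tV : ℂ) ^ 10 * gaussCol A B 2 p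
      - (tV : ℂ) ^ 30 * gaussCol A B 3 p := fun p ↦ by
    rw [eh₁, map_sub, map_sub, map_smul, map_smul, hM, hM, hM]; rfl
  have v₂ : ∀ p, M h₂ p = gaussCol A B 1 p - (tV : ℂ) ^ 20 * gaussCol A B 2 p
      - (tV : ℂ) ^ 50 * gaussCol A B 3 p := fun p ↦ by
    rw [eh₂, map_sub, map_sub, map_smul, map_smul, hM, hM, hM]; rfl
  rw [mem_NP, Pmap_apply] at hM₁ hM₂
  have e1 := congrFun hM₁ 0
  have e2 := congrFun hM₁ 1
  have e3 := congrFun hM₂ 0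
  have e4 := congrFun hM₂ 1
  simp only [Matrix.cons_val_zero, Matrix.cons_val_one, Pi.zero_apply, v₁, v₂, gaussCol] at e1 e2 e3 e4
  have r1 := congrArg Complex.re e1; have i1 := congrArg Complex.im e1
  have r2 := congrArg Complex.re e2; have i2 := congrArg Complex.im e2
  have r3 := congrArg Complex.re e3; have i3 := congrArg Complex.im e3
  have r4 := congrArg Complex.re e4; have i4 := congrArg Complex.im e4
  simp only [← Complex.ofReal_pow, Complex.add_re, Complex.add_im, Complex.sub_re, Complex.sub_im,
    Complex.mul_re, Complex.mul_im, Complex.ofReal_re, Complex.ofReal_im, gaussVec_re, gaussVec_im,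
    Complex.zero_re, Complex.zero_im, add_zero, zero_mul, sub_zero] at r1 i1 r2 i2 r3 i3 r4 i4
  have X1 := eq_zero_of_sum_rat_mul_pow_eq_zero {0, 1, 2, 10, 11, 12, 30, 31, 32}
    (fun n ↦ if n = 0 then A 0 0 else if n = 1 then A 2 0 else if n = 2 then A 3 0 else if n = 10 then -A 0 2 else if n = 11 then -A 2 2 else if n = 12 then -A 3 2 else if n = 30 then -A 0 3 else if n = 31 then -A 2 3 else -A 3 3) (by
      norm_num; linear_combination r1)
  have Y1 := eq_zero_of_sum_rat_mul_pow_eq_zero {0, 1, 2, 10, 11, 12, 30, 31, 32}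
    (fun n ↦ if n = 0 then B 0 0 else if n = 1 then B 2 0 else if n = 2 then B 3 0 else if n = 10 then -B 0 2 else if n = 11 then -B 2 2 else if n = 12 then -B 3 2 else if n = 30 then -B 0 3 else if n = 31 then -B 2 3 else -B 3 3) (by
      norm_num; linear_combination i1)
  have X2 := eq_zero_of_sum_rat_mul_pow_eq_zero {0, 3, 5, 10, 13, 15, 30, 33, 35}
    (fun n ↦ if n = 0 then A 1 0 else if n = 3 then A 2 0 else if n = 5 then A 3 0 else if n = 10 then -A 1 2 else if n = 13 then -A 2 2 else if n = 15 then -A 3 2 else if n = 30 then -A 1 3 else if n = 33 then -A 2 3 else -A 3 3) (by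
      norm_num; linear_combination r2)
  have Y2 := eq_zero_of_sum_rat_mul_pow_eq_zero {0, 3, 5, 10, 13, 15, 30, 33, 35}
    (fun n ↦ if n = 0 then B 1 0 else if n = 3 then B 2 0 else if n = 5 then B 3 0 else if n = 10 then -B 1 2 else if n = 13 then -B 2 2 else if n = 15 then -B 3 2 else if n = 30 then -B 1 3 else if n = 33 then -B 2 3 else -B 3 3) (by
      norm_num; linear_combination i2)
  have X3 := eq_zero_of_sum_rat_mul_pow_eq_zero {0, 1, 2, 20, 21, 22, 50, 51, 52}
    (fun n ↦ if n = 0 then A 0 1 else if n = 1 then A 2 1 else if n = 2 then A 3 1 else if n = 20 then -A 0 2 else if n = 21 then -A 2 2 else if n = 22 then -A 3 2 else if n = 50 then -A 0 3 else if n = 51 then -A 2 3 else -A 3 3) (by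
      norm_num; linear_combination r3)
  have Y3 := eq_zero_of_sum_rat_mul_pow_eq_zero {0, 1, 2, 20, 21, 22, 50, 51, 52}
    (fun n ↦ if n = 0 then B 0 1 else if n = 1 then B 2 1 else if n = 2 then B 3 1 else if n = 20 then -B 0 2 else if n = 21 then -B 2 2 else if n = 22 then -B 3 2 else if n = 50 then -B 0 3 else if n = 51 then -B 2 3 else -B 3 3) (by
      norm_num; linear_combination i3)
  have X4 := eq_zero_of_sum_rat_mul_pow_eq_zero {0, 3, 5, 20, 23, 25, 50, 53, 55}
    (fun n ↦ if n = 0 then A 1 1 else if n = 3 then A 2 1 else if n = 5 then A 3 1 else if n = 20 then -A 1 2 else if n = 23 then -A 2 2 else if n = 25 then -A 3 2 else if n = 50 then -A 1 3 else if n = 53 then -A 2 3 else -A 3 3) (by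
      norm_num; linear_combination r4)
  have Y4 := eq_zero_of_sum_rat_mul_pow_eq_zero {0, 3, 5, 20, 23, 25, 50, 53, 55}
    (fun n ↦ if n = 0 then B 1 1 else if n = 3 then B 2 1 else if n = 5 then B 3 1 else if n = 20 then -B 1 2 else if n = 23 then -B 2 2 else if n = 25 then -B 3 2 else if n = 50 then -B 1 3 else if n = 53 then -B 2 3 else -B 3 3) (by
      norm_num; linear_combination i4)
  have a00 := X1 0 (by simp); have a20 := X1 1 (by simp); have a30 := X1 2 (by simp)
  have a02 := X1 10 (by simp); have a22 := X1 11 (by simp); have a32 := X1 12 (by simp)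
  have a03 := X1 30 (by simp); have a23 := X1 31 (by simp); have a33 := X1 32 (by simp)
  have a10 := X2 0 (by simp); have a12 := X2 10 (by simp); have a13 := X2 30 (by simp)
  have a01 := X3 0 (by simp); have a21 := X3 1 (by simp); have a31 := X3 2 (by simp)
  have a11 := X4 0 (by simp)
  have b00 := Y1 0 (by simp); have b20 := Y1 1 (by simp); have b30 := Y1 2 (by simp)
  have b02 := Y1 10 (by simp); have b22 := Y1 11 (by simp); have b32 := Y1 12 (by simp)
  have b03 := Y1 30 (by simp); have b23 := Y1 31 (by simp); have b33 := Y1 32 (by simp)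
  have b10 := Y2 0 (by simp); have b12 := Y2 10 (by simp); have b13 := Y2 30 (by simp)
  have b01 := Y3 0 (by simp); have b21 := Y3 1 (by simp); have b31 := Y3 2 (by simp)
  have b11 := Y4 0 (by simp)
  norm_num at a00 a20 a30 a02 a22 a32 a03 a23 a33 a10 a12 a13 a01 a21 a31 a11
  norm_num at b00 b20 b30 b02 b22 b32 b03 b23 b33 b10 b12 b13 b01 b21 b31 b11
  refine LinearMap.pi_ext' fun q ↦ LinearMap.ext_ring ?_
  change M (Pi.single q 1) = 0
  rw [hM]
  funext p
  fin_cases q <;> fin_cases p <;> apply Complex.ext <;> simp [gaussCol] <;> assumption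

end Weil

end Literature.Geometry.Kaehler

end
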